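/-
Origin: expansion seat `planner-pub-hodgecm-pv14-g6-0`, handover none (imports installed HodgeCM.Automorphic.SchwartzChirp + SchwartzModulation only) ; any order (independent of rows 1-7) (`HOME/pub-hodgecm-pv14-g6/lean/Pv14g6/SchwartzMultiplierDeriv.lean`, md5 1f59e30f, 384 lines);
landed by the gen-8 packager in gate run 30 as `HodgeCM/Automorphic/SchwartzMultiplierDeriv.lean` (verbatim).
-/
/-
Copyright (c) 2026. All rights reserved.
Released under Apache 2.0 license as described in the file LICENSE.
Origin: pub-hodgecm-pv14-g6 (DAG-node prover #14, gen 6), file #10; target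
`HodgeCM/Automorphic/SchwartzMultiplierDeriv.lean` (namespace `HodgeCM.SchwartzWeil`).  NEW ADDITIVE LEAF;
imports only installed modules.
-/
import Summits.HodgeConjecture.HodgeCM.Automorphic.SchwartzChirp
import Summits.HodgeConjecture.HodgeCM.Automorphic.SchwartzModulation

/-!
# One-parameter multiplier groups on Schwartz space are differentiable at the origin

Let `g : V → ℝ` have temperate growth and let `E_s Φ = 𝐞(s·g) Φ` (`s : ℝ`) be the unitary multiplier group it
generates on `𝓢(V, ℂ)` (`SchwartzMap.smulLeftCLM`).  We prove, in the SCHWARTZ TOPOLOGY,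

  `s⁻¹ • (E_s Φ - Φ) ⟶ (2πi g) Φ`  as `s → 0`, `s ≠ 0`
  (`HodgeCM.SchwartzWeil.tendsto_smulLeftCLM_fourierChar_sub_div`),

i.e. every Schwartz function is a differentiable vector of every such group, with derivative the multiplication
operator by `2πi g`.  Specialisations: the chirps `T_s Φ = 𝐞(s‖x‖²) Φ` of the metaplectic unipotent radical
(`tendsto_chirpCLM_sub_div`, generator `2πi‖x‖²`) and the Heisenberg modulations `M_{sb} Φ = 𝐞(s⟪b, x⟫) Φ`
(`tendsto_modCLM_smul_sub_div`, generator `2πi⟪b, x⟫`).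

The proof is an explicit seminorm estimate: with `r_s(u) = s⁻¹(𝐞(su) - 1) - 2πiu` one has
`|r_s^{(j)}(u)| ≤ |s| (2π)^{n+2} (1 + |u|)²` for `j ≤ n`, `|s| ≤ 1` (`norm_iteratedDeriv_expRem_le`), a
quantitative Faà di Bruno bound for `r_s ∘ g` (`norm_iteratedFDeriv_comp_le_of_growth`), and the Leibniz rule
(`seminorm_le_of_mul`), giving `p_{k,n}(s⁻¹(E_sΦ - Φ) - 2πi g Φ) ≤ |s| · M`.

Not here: higher derivatives in `s`, joint smoothness, or the translation group (which follows by Fourier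
conjugation but is not spelled out).
-/

noncomputable section

open scoped Real FourierTransform SchwartzMap RealInnerProductSpace Topology Nat
open Complex Filter

namespace HodgeCM
namespace SchwartzWeil

/-! ## 1. The scalar remainder `r_s(u) = s⁻¹ (𝐞(su) - 1) - 2πi u` -/

section Scalar

/-- `expRem s u = s⁻¹ (𝐞 (s u) - 1) - 2π i u`. -/
def expRem (s u : ℝ) : ℂ := (s : ℂ)⁻¹ * ((𝐞 (s * u) : ℂ) - 1) - 2 * π * I * u

/-- (Ported verbatim from the HodgeCMPerL package; no docstring in the source.) -/
theorem expRem_zero_right (s : ℝ) : expRem s 0 = 0 := by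
  simp [expRem]

/-- (Ported verbatim from the HodgeCMPerL package; no docstring in the source.) -/
theorem hasDerivAt_fourierChar_mul (s u : ℝ) :
    HasDerivAt (fun u : ℝ => (𝐞 (s * u) : ℂ)) (2 * π * I * s * 𝐞 (s * u)) u := by
  have h0 : HasDerivAt (fun u : ℝ => s * u) s u := by simpa using (hasDerivAt_id' u).const_mul s
  have h := (Real.hasDerivAt_fourierChar (s * u)).scomp u h0
  refine h.congr_deriv ?_
  rw [Complex.real_smul]
  ring

/-- (Ported verbatim from the HodgeCMPerL package; no docstring in the source.) -/
theorem contDiff_fourierChar_mul (s : ℝ) : ContDiff ℝ (⊤ : ℕ∞) (fun u : ℝ => (𝐞 (s * u) : ℂ)) :=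
  contDiff_fourierChar.comp (contDiff_const.mul contDiff_id)

/-- (Ported verbatim from the HodgeCMPerL package; no docstring in the source.) -/
theorem contDiff_expRem (s : ℝ) : ContDiff ℝ (⊤ : ℕ∞) (expRem s) :=
  (contDiff_const.mul ((contDiff_fourierChar_mul s).sub contDiff_const)).sub
    (contDiff_const.mul ofRealCLM.contDiff)

/-- (Ported verbatim from the HodgeCMPerL package; no docstring in the source.) -/
theorem hasDerivAt_expRem {s : ℝ} (hs : s ≠ 0) (u : ℝ) :
    HasDerivAt (expRem s) (2 * π * I * ((𝐞 (s * u) : ℂ) - 1)) u := by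
  have h1 := ((hasDerivAt_fourierChar_mul s u).sub_const (1 : ℂ)).const_mul ((s : ℂ)⁻¹)
  have h2 : HasDerivAt (fun y : ℝ => 2 * π * I * (y : ℂ)) (2 * π * I) u := by
    simpa using (ofRealCLM.hasDerivAt (x := u)).const_mul (2 * π * I)
  have h : HasDerivAt (expRem s) ((s : ℂ)⁻¹ * (2 * π * I * s * 𝐞 (s * u)) - 2 * π * I) u := h1.sub h2
  have hs' : (s : ℂ) ≠ 0 := ofReal_ne_zero.mpr hs
  refine h.congr_deriv ?_
  field_simp

/-- (Ported verbatim from the HodgeCMPerL package; no docstring in the source.) -/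
theorem deriv_expRem {s : ℝ} (hs : s ≠ 0) :
    deriv (expRem s) = fun u => 2 * π * I * ((𝐞 (s * u) : ℂ) - 1) :=
  funext fun u => (hasDerivAt_expRem hs u).deriv

/-- (Ported verbatim from the HodgeCMPerL package; no docstring in the source.) -/
theorem deriv_deriv_expRem {s : ℝ} (hs : s ≠ 0) :
    deriv (deriv (expRem s)) = fun u => 2 * π * I * (2 * π * I * s) * (𝐞 (s * u) : ℂ) := by
  rw [deriv_expRem hs]
  funext u
  rw [(((hasDerivAt_fourierChar_mul s u).sub_const (1 : ℂ)).const_mul (2 * π * I)).deriv]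
  ring

/-- (Ported verbatim from the HodgeCMPerL package; no docstring in the source.) -/
theorem iteratedDeriv_const_mul_fourierChar_mul (A : ℂ) (s : ℝ) (j : ℕ) :
    iteratedDeriv j (fun u : ℝ => A * (𝐞 (s * u) : ℂ)) = fun u => A * (2 * π * I * s) ^ j * (𝐞 (s * u) : ℂ) := by
  induction j with
  | zero => funext u; rw [iteratedDeriv_zero, pow_zero, mul_one]
  | succ j ih =>
    rw [iteratedDeriv_succ, ih]
    funext u
    rw [((hasDerivAt_fourierChar_mul s u).const_mul (A * (2 * π * I * s) ^ j)).deriv, pow_succ]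
    ring

/-- (Ported verbatim from the HodgeCMPerL package; no docstring in the source.) -/
theorem iteratedDeriv_expRem_add_two {s : ℝ} (hs : s ≠ 0) (j : ℕ) :
    iteratedDeriv (j + 2) (expRem s) =
      fun u => 2 * π * I * (2 * π * I * s) * (2 * π * I * s) ^ j * (𝐞 (s * u) : ℂ) := by
  rw [iteratedDeriv_succ', iteratedDeriv_succ', deriv_deriv_expRem hs, iteratedDeriv_const_mul_fourierChar_mul]

/-- (Ported verbatim from the HodgeCMPerL package; no docstring in the source.) -/
theorem norm_two_pi_I_mul (s : ℝ) : ‖(2 * π * I * s : ℂ)‖ = 2 * π * |s| := by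
  rw [norm_mul, norm_two_pi_I, norm_real, Real.norm_eq_abs]

/-- `‖𝐞 t - 1‖ ≤ 2π |t|`. -/
theorem norm_fourierChar_sub_one_le (t : ℝ) : ‖(𝐞 t : ℂ) - 1‖ ≤ 2 * π * |t| := by
  have h := convex_univ.norm_image_sub_le_of_norm_hasDerivWithin_le (f := fun y : ℝ => (𝐞 y : ℂ))
    (f' := fun y => 2 * π * I * 𝐞 y) (C := 2 * π) (x := 0) (y := t)
    (fun y _ => (Real.hasDerivAt_fourierChar y).hasDerivWithinAt)
    (fun y _ => by rw [norm_mul, norm_two_pi_I, Circle.norm_coe, mul_one]) (Set.mem_univ _) (Set.mem_univ _)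
  simpa [Real.norm_eq_abs] using h

/-- (Ported verbatim from the HodgeCMPerL package; no docstring in the source.) -/
theorem one_le_two_pi : (1 : ℝ) ≤ 2 * π := by linarith [Real.pi_gt_three]

/-- `‖r_s'(u)‖ ≤ 4π² |s| |u|`. -/
theorem norm_deriv_expRem_le {s : ℝ} (hs : s ≠ 0) (u : ℝ) :
    ‖deriv (expRem s) u‖ ≤ (2 * π) ^ 2 * |s| * |u| := by
  rw [deriv_expRem hs, norm_mul, norm_two_pi_I]
  calc 2 * π * ‖(𝐞 (s * u) : ℂ) - 1‖ ≤ 2 * π * (2 * π * |s * u|) := by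
        gcongr; exact norm_fourierChar_sub_one_le _
    _ = (2 * π) ^ 2 * |s| * |u| := by rw [abs_mul]; ring

/-- `‖r_s(u)‖ ≤ 4π² |s| u²`. -/
theorem norm_expRem_le {s : ℝ} (hs : s ≠ 0) (u : ℝ) : ‖expRem s u‖ ≤ (2 * π) ^ 2 * |s| * |u| ^ 2 := by
  have h := (convex_uIcc (0 : ℝ) u).norm_image_sub_le_of_norm_hasDerivWithin_le (f := expRem s)
    (f' := deriv (expRem s)) (C := (2 * π) ^ 2 * |s| * |u|) (x := 0) (y := u)
    (fun y _ => ((hasDerivAt_expRem hs y).differentiableAt.hasDerivAt).hasDerivWithinAt)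
    (fun y hy => by
      calc ‖deriv (expRem s) y‖ ≤ (2 * π) ^ 2 * |s| * |y| := norm_deriv_expRem_le hs y
        _ ≤ (2 * π) ^ 2 * |s| * |u| :=
          mul_le_mul_of_nonneg_left (by simpa using Set.abs_sub_left_of_mem_uIcc hy) (by positivity))
    Set.left_mem_uIcc Set.right_mem_uIcc
  rw [expRem_zero_right, sub_zero, sub_zero, Real.norm_eq_abs] at h
  calc ‖expRem s u‖ ≤ (2 * π) ^ 2 * |s| * |u| * |u| := h
    _ = (2 * π) ^ 2 * |s| * |u| ^ 2 := by ring

/-- **Uniform bound on the derivatives of `r_s`**: for `0 < |s| ≤ 1` and `j ≤ n`,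
`‖r_s^{(j)}(u)‖ ≤ |s| (2π)^{n+2} (1 + |u|)²`. -/
theorem norm_iteratedDeriv_expRem_le {s : ℝ} (hs : s ≠ 0) (hs1 : |s| ≤ 1) {n j : ℕ} (hj : j ≤ n) (u : ℝ) :
    ‖iteratedDeriv j (expRem s) u‖ ≤ |s| * (2 * π) ^ (n + 2) * (1 + |u|) ^ 2 := by
  have hs0 : 0 < |s| := abs_pos.mpr hs
  have h2pi : (2 * π) ^ 2 ≤ (2 * π) ^ (n + 2) := pow_le_pow_right₀ one_le_two_pi (by omega)
  have hu1 : |u| ≤ (1 + |u|) ^ 2 := by nlinarith [abs_nonneg u]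
  have hu2 : |u| ^ 2 ≤ (1 + |u|) ^ 2 := by nlinarith [abs_nonneg u]
  have hu0 : (1 : ℝ) ≤ (1 + |u|) ^ 2 := by nlinarith [abs_nonneg u]
  rcases j with _ | _ | j
  · rw [iteratedDeriv_zero]
    calc ‖expRem s u‖ ≤ (2 * π) ^ 2 * |s| * |u| ^ 2 := norm_expRem_le hs u
      _ ≤ (2 * π) ^ (n + 2) * |s| * (1 + |u|) ^ 2 := by gcongr
      _ = _ := by ring
  · rw [iteratedDeriv_one]
    calc ‖deriv (expRem s) u‖ ≤ (2 * π) ^ 2 * |s| * |u| := norm_deriv_expRem_le hs u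
      _ ≤ (2 * π) ^ (n + 2) * |s| * (1 + |u|) ^ 2 := by gcongr
      _ = _ := by ring
  · rw [iteratedDeriv_expRem_add_two hs]
    simp only
    rw [norm_mul, norm_mul, norm_mul, norm_pow, norm_two_pi_I, norm_two_pi_I_mul, Circle.norm_coe, mul_one]
    have hsj : |s| ^ (j + 1) ≤ |s| := pow_le_of_le_one hs0.le hs1 (by omega)
    calc 2 * π * (2 * π * |s|) * (2 * π * |s|) ^ j = (2 * π) ^ (j + 2) * |s| ^ (j + 1) := by ring
      _ ≤ (2 * π) ^ (n + 2) * |s| := by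
        gcongr
        · exact one_le_two_pi
        · omega
      _ = |s| * (2 * π) ^ (n + 2) * 1 := by ring
      _ ≤ |s| * (2 * π) ^ (n + 2) * (1 + |u|) ^ 2 := by gcongr

/-- The same bound for the Fréchet derivatives of `r_s : ℝ → ℂ`. -/
theorem norm_iteratedFDeriv_expRem_le {s : ℝ} (hs : s ≠ 0) (hs1 : |s| ≤ 1) {n j : ℕ} (hj : j ≤ n) (u : ℝ) :
    ‖iteratedFDeriv ℝ j (expRem s) u‖ ≤ |s| * (2 * π) ^ (n + 2) * (1 + ‖u‖) ^ 2 := by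
  rw [norm_iteratedFDeriv_eq_norm_iteratedDeriv, Real.norm_eq_abs]
  exact norm_iteratedDeriv_expRem_le hs hs1 hj u

end Scalar

/-! ## 2. A quantitative Faà di Bruno bound -/

section Comp

variable {E F G : Type*} [NormedAddCommGroup E] [NormedSpace ℝ E] [NormedAddCommGroup F] [NormedSpace ℝ F]
  [NormedAddCommGroup G] [NormedSpace ℝ G]

/-- **Derivatives of a composite with explicit polynomial constants.**  If the derivatives of `f` of orders
`≤ n` are bounded by `C₁ (1 + ‖x‖)^{k₁}` and those of `g` by `C₂ (1 + ‖y‖)^{k₂}`, then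
`‖Dⁿ(g ∘ f)(x)‖ ≤ n! · C₂ (1 + C₁)^{k₂ + n} · (1 + ‖x‖)^{k₁ k₂ + k₁ n}`.  (The constant is linear in `C₂`.) -/
theorem norm_iteratedFDeriv_comp_le_of_growth {g : F → G} {f : E → F} (hg : ContDiff ℝ (⊤ : ℕ∞) g)
    (hf : ContDiff ℝ (⊤ : ℕ∞) f) {n k₁ k₂ : ℕ} {C₁ C₂ : ℝ} (hC₁ : 0 ≤ C₁) (hC₂ : 0 ≤ C₂)
    (h₁ : ∀ i ≤ n, ∀ x, ‖iteratedFDeriv ℝ i f x‖ ≤ C₁ * (1 + ‖x‖) ^ k₁)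
    (h₂ : ∀ i ≤ n, ∀ y, ‖iteratedFDeriv ℝ i g y‖ ≤ C₂ * (1 + ‖y‖) ^ k₂) (x : E) :
    ‖iteratedFDeriv ℝ n (g ∘ f) x‖ ≤
      n ! * (C₂ * (1 + C₁) ^ (k₂ + n)) * (1 + ‖x‖) ^ (k₁ * k₂ + k₁ * n) := by
  have hx1 : (1 : ℝ) ≤ (1 + ‖x‖) ^ k₁ := one_le_pow₀ (by simp)
  have hfx : ‖f x‖ ≤ C₁ * (1 + ‖x‖) ^ k₁ := by simpa using h₁ 0 (Nat.zero_le _) x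
  have hfx' : 1 + ‖f x‖ ≤ (1 + C₁) * (1 + ‖x‖) ^ k₁ := by
    calc 1 + ‖f x‖ ≤ (1 + ‖x‖) ^ k₁ + C₁ * (1 + ‖x‖) ^ k₁ := add_le_add hx1 hfx
      _ = (1 + C₁) * (1 + ‖x‖) ^ k₁ := by ring
  have hg' : ∀ i, i ≤ n → ‖iteratedFDeriv ℝ i g (f x)‖ ≤ C₂ * (1 + C₁) ^ k₂ * (1 + ‖x‖) ^ (k₁ * k₂) := by
    intro i hi
    calc ‖iteratedFDeriv ℝ i g (f x)‖ ≤ C₂ * (1 + ‖f x‖) ^ k₂ := h₂ i hi (f x)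
      _ ≤ C₂ * ((1 + C₁) * (1 + ‖x‖) ^ k₁) ^ k₂ := by gcongr
      _ = C₂ * (1 + C₁) ^ k₂ * (1 + ‖x‖) ^ (k₁ * k₂) := by rw [mul_pow, ← pow_mul]; ring
  have hf' : ∀ i, 1 ≤ i → i ≤ n → ‖iteratedFDeriv ℝ i f x‖ ≤ ((1 + C₁) * (1 + ‖x‖) ^ k₁) ^ i := by
    intro i hi hi'
    calc ‖iteratedFDeriv ℝ i f x‖ ≤ C₁ * (1 + ‖x‖) ^ k₁ := h₁ i hi' x
      _ ≤ (1 + C₁) * (1 + ‖x‖) ^ k₁ := by gcongr; simp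
      _ ≤ ((1 + C₁) * (1 + ‖x‖) ^ k₁) ^ i :=
        le_self_pow₀ (one_le_mul_of_one_le_of_one_le (by linarith) hx1) (by omega)
  calc ‖iteratedFDeriv ℝ n (g ∘ f) x‖
      ≤ n ! * (C₂ * (1 + C₁) ^ k₂ * (1 + ‖x‖) ^ (k₁ * k₂)) * ((1 + C₁) * (1 + ‖x‖) ^ k₁) ^ n :=
        norm_iteratedFDeriv_comp_le hg hf (mod_cast le_top) x hg' hf'
    _ = _ := by rw [mul_pow, ← pow_mul, pow_add, pow_add]; ring

end Comp

/-! ## 3. The Leibniz estimate for Schwartz seminorms -/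

section Leibniz

variable {V : Type*} [NormedAddCommGroup V] [NormedSpace ℝ V]

/-- **Seminorms of a product `h · Φ`** with `‖Dⁱh(x)‖ ≤ δ (1 + ‖x‖)^p` (`i ≤ n`):
`p_{k,n}(Ψ) ≤ δ · 2^{k+p+n} · sup_{(k',n') ≤ (k+p,n)} p_{k',n'}(Φ)` whenever `Ψ = h · Φ` pointwise. -/
theorem seminorm_le_of_mul {h : V → ℂ} (hh : ContDiff ℝ (⊤ : ℕ∞) h) {n k p : ℕ} {δ : ℝ} (hδ : 0 ≤ δ)
    (hb : ∀ i ≤ n, ∀ x, ‖iteratedFDeriv ℝ i h x‖ ≤ δ * (1 + ‖x‖) ^ p) (Φ Ψ : 𝓢(V, ℂ))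
    (hΨ : ∀ x, Ψ x = h x * Φ x) :
    SchwartzMap.seminorm ℂ k n Ψ ≤
      δ * (2 ^ (k + p + n) * (Finset.Iic (k + p, n)).sup (schwartzSeminormFamily ℂ V ℂ) Φ) := by
  set S := (Finset.Iic (k + p, n)).sup (schwartzSeminormFamily ℂ V ℂ) Φ with hS
  have hS0 : 0 ≤ S := apply_nonneg _ _
  have hΨ' : (⇑Ψ : V → ℂ) = fun x => h x * Φ x := funext hΨ
  refine SchwartzMap.seminorm_le_bound ℂ k n Ψ (by positivity) fun x => ?_
  rw [hΨ']
  have hx0 : 0 ≤ ‖x‖ := norm_nonneg _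
  have hL := norm_iteratedFDeriv_mul_le (n := n) hh (Φ.smooth ⊤) x (mod_cast le_top)
  have hterm : ∀ i ∈ Finset.range (n + 1),
      ‖x‖ ^ k * ((n.choose i : ℝ) * ‖iteratedFDeriv ℝ i h x‖ * ‖iteratedFDeriv ℝ (n - i) Φ x‖) ≤
        (n.choose i : ℝ) * (δ * (2 ^ (k + p) * S)) := by
    intro i hi
    have hi' : i ≤ n := Nat.lt_succ_iff.mp (Finset.mem_range.mp hi)
    have h1 := hb i hi' x
    have h2 : (1 + ‖x‖) ^ (k + p) * ‖iteratedFDeriv ℝ (n - i) Φ x‖ ≤ 2 ^ (k + p) * S :=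
      SchwartzMap.one_add_le_sup_seminorm_apply (m := (k + p, n)) le_rfl (Nat.sub_le n i) Φ x
    have hxk : ‖x‖ ^ k ≤ (1 + ‖x‖) ^ k := pow_le_pow_left₀ hx0 (by linarith) k
    calc ‖x‖ ^ k * ((n.choose i : ℝ) * ‖iteratedFDeriv ℝ i h x‖ * ‖iteratedFDeriv ℝ (n - i) Φ x‖)
        ≤ (1 + ‖x‖) ^ k * ((n.choose i : ℝ) * (δ * (1 + ‖x‖) ^ p) * ‖iteratedFDeriv ℝ (n - i) Φ x‖) := by
          gcongr
      _ = (n.choose i : ℝ) * δ * ((1 + ‖x‖) ^ (k + p) * ‖iteratedFDeriv ℝ (n - i) Φ x‖) := by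
          rw [pow_add]; ring
      _ ≤ (n.choose i : ℝ) * δ * (2 ^ (k + p) * S) := by gcongr
      _ = _ := by ring
  calc ‖x‖ ^ k * ‖iteratedFDeriv ℝ n (fun x => h x * Φ x) x‖
      ≤ ‖x‖ ^ k * ∑ i ∈ Finset.range (n + 1),
          (n.choose i : ℝ) * ‖iteratedFDeriv ℝ i h x‖ * ‖iteratedFDeriv ℝ (n - i) Φ x‖ := by gcongr
    _ = ∑ i ∈ Finset.range (n + 1),
          ‖x‖ ^ k * ((n.choose i : ℝ) * ‖iteratedFDeriv ℝ i h x‖ * ‖iteratedFDeriv ℝ (n - i) Φ x‖) :=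
        Finset.mul_sum _ _ _
    _ ≤ ∑ i ∈ Finset.range (n + 1), (n.choose i : ℝ) * (δ * (2 ^ (k + p) * S)) := Finset.sum_le_sum hterm
    _ = (2 : ℝ) ^ n * (δ * (2 ^ (k + p) * S)) := by
        rw [← Finset.sum_mul]; congr 1; exact_mod_cast Nat.sum_range_choose n
    _ = δ * (2 ^ (k + p + n) * S) := by rw [pow_add]; ring

end Leibniz

/-! ## 4. Differentiability of multiplier groups at the origin -/

section Main

variable {V : Type*} [NormedAddCommGroup V] [NormedSpace ℝ V] {g : V → ℝ}

/-- (Ported verbatim from the HodgeCMPerL package; no docstring in the source.) -/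
theorem hasTemperateGrowth_fourierChar_mul_comp (hg : g.HasTemperateGrowth) (s : ℝ) :
    (fun x => (𝐞 (s * g x) : ℂ)).HasTemperateGrowth :=
  hasTemperateGrowth_fourierChar.comp (f := fun x => s * g x) ((Function.HasTemperateGrowth.const s).mul hg)

/-- (Ported verbatim from the HodgeCMPerL package; no docstring in the source.) -/
theorem hasTemperateGrowth_two_pi_I_mul (hg : g.HasTemperateGrowth) :
    (fun x => 2 * π * I * (g x : ℂ)).HasTemperateGrowth := by
  fun_prop

/-- The derivatives of `r_s ∘ g` are `O(|s|)` with polynomial weights, uniformly in the order `≤ n`. -/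
theorem norm_iteratedFDeriv_expRem_comp_le (hg : g.HasTemperateGrowth) (n : ℕ) :
    ∃ (p : ℕ) (K : ℝ), 0 ≤ K ∧ ∀ s : ℝ, s ≠ 0 → |s| ≤ 1 → ∀ i ≤ n, ∀ x,
      ‖iteratedFDeriv ℝ i (expRem s ∘ g) x‖ ≤ |s| * K * (1 + ‖x‖) ^ p := by
  obtain ⟨k₁, C₁, hC₁, h₁⟩ := hg.norm_iteratedFDeriv_le_uniform n
  refine ⟨k₁ * 2 + k₁ * n, n ! * ((2 * π) ^ (n + 2) * (1 + C₁) ^ (2 + n)), by positivity,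
    fun s hs hs1 i hi x => ?_⟩
  have hx1 : (1 : ℝ) ≤ 1 + ‖x‖ := by simp
  have h := norm_iteratedFDeriv_comp_le_of_growth (n := i) (k₁ := k₁) (k₂ := 2) (C₁ := C₁)
    (C₂ := |s| * (2 * π) ^ (n + 2)) (contDiff_expRem s) hg.1 hC₁ (by positivity)
    (fun j hj y => h₁ j (hj.trans hi) y) (fun j hj y => norm_iteratedFDeriv_expRem_le hs hs1 (hj.trans hi) y) x
  calc ‖iteratedFDeriv ℝ i (expRem s ∘ g) x‖
      ≤ i ! * (|s| * (2 * π) ^ (n + 2) * (1 + C₁) ^ (2 + i)) * (1 + ‖x‖) ^ (k₁ * 2 + k₁ * i) := h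
    _ ≤ n ! * (|s| * (2 * π) ^ (n + 2) * (1 + C₁) ^ (2 + n)) * (1 + ‖x‖) ^ (k₁ * 2 + k₁ * n) := by
        gcongr
        linarith
    _ = _ := by ring

/-- **Schwartz functions are differentiable vectors of every temperate multiplier group.**  For `g : V → ℝ`
of temperate growth and `Φ ∈ 𝓢(V, ℂ)`,
`s⁻¹ (𝐞(s g) Φ - Φ) → (2πi g) Φ` in `𝓢(V, ℂ)` as `s → 0`, `s ≠ 0`. -/
theorem tendsto_smulLeftCLM_fourierChar_sub_div (hg : g.HasTemperateGrowth) (Φ : 𝓢(V, ℂ)) :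
    Tendsto (fun s : ℝ => s⁻¹ • (SchwartzMap.smulLeftCLM ℂ (fun x => (𝐞 (s * g x) : ℂ)) Φ - Φ)) (𝓝[≠] 0)
      (𝓝 (SchwartzMap.smulLeftCLM ℂ (fun x => 2 * π * I * (g x : ℂ)) Φ)) := by
  rw [(schwartz_withSeminorms ℂ V ℂ).tendsto_nhds]
  rintro ⟨k, n⟩ ε hε
  obtain ⟨p, K, hK, hb⟩ := norm_iteratedFDeriv_expRem_comp_le hg n
  set S := (Finset.Iic (k + p, n)).sup (schwartzSeminormFamily ℂ V ℂ) Φ with hS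
  have hS0 : 0 ≤ S := apply_nonneg _ _
  set M := K * (2 ^ (k + p + n) * S) with hM
  have hM0 : 0 ≤ M := by positivity
  have hM1 : 0 < M + 1 := by linarith
  have hη : 0 < min 1 (ε / (M + 1)) := lt_min one_pos (div_pos hε hM1)
  rw [eventually_nhdsWithin_iff, Metric.eventually_nhds_iff]
  refine ⟨min 1 (ε / (M + 1)), hη, fun s hs hs0 => ?_⟩
  rw [Real.dist_eq, sub_zero] at hs
  have hs1 : |s| ≤ 1 := (hs.trans_le (min_le_left _ _)).le
  have hsε : |s| * M < ε := by
    have h1 : |s| * (M + 1) < ε := by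
      rw [← lt_div_iff₀ hM1]; exact hs.trans_le (min_le_right _ _)
    have h2 : |s| * M ≤ |s| * (M + 1) := mul_le_mul_of_nonneg_left (by linarith) (abs_nonneg s)
    exact h2.trans_lt h1
  have hΨ : ∀ x, (s⁻¹ • (SchwartzMap.smulLeftCLM ℂ (fun x => (𝐞 (s * g x) : ℂ)) Φ - Φ) -
      SchwartzMap.smulLeftCLM ℂ (fun x => 2 * π * I * (g x : ℂ)) Φ) x = (expRem s ∘ g) x * Φ x := by
    intro x
    rw [sub_apply, smul_apply, sub_apply,
      SchwartzMap.smulLeftCLM_apply_apply (hasTemperateGrowth_fourierChar_mul_comp hg s),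
      SchwartzMap.smulLeftCLM_apply_apply (hasTemperateGrowth_two_pi_I_mul hg), Function.comp_apply, expRem,
      smul_eq_mul, smul_eq_mul, Complex.real_smul, ofReal_inv]
    ring
  have hmain := seminorm_le_of_mul (k := k) ((contDiff_expRem s).comp hg.1) (by positivity : 0 ≤ |s| * K)
    (hb s hs0 hs1) Φ _ hΨ
  calc schwartzSeminormFamily ℂ V ℂ (k, n) _ ≤ |s| * K * (2 ^ (k + p + n) * S) := hmain
    _ = |s| * M := by rw [hM]; ring
    _ < ε := hsε

/-- **Vector-valued form.**  For every continuous `ℝ`-linear `T : 𝓢(V, ℂ) → F` (e.g. a matrix coefficient,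
a tempered distribution, a continuous operator followed by one), `s ↦ T (𝐞(s g) Φ)` has derivative
`T ((2πi g) Φ)` at `s = 0`. -/
theorem hasDerivAt_smulLeftCLM_fourierChar {F : Type*} [NormedAddCommGroup F] [NormedSpace ℝ F]
    (hg : g.HasTemperateGrowth) (Φ : 𝓢(V, ℂ)) (T : 𝓢(V, ℂ) →L[ℝ] F) :
    HasDerivAt (fun s : ℝ => T (SchwartzMap.smulLeftCLM ℂ (fun x => (𝐞 (s * g x) : ℂ)) Φ))
      (T (SchwartzMap.smulLeftCLM ℂ (fun x => 2 * π * I * (g x : ℂ)) Φ)) 0 := by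
  rw [hasDerivAt_iff_tendsto_slope_zero]
  have h := (T.continuous.tendsto _).comp (tendsto_smulLeftCLM_fourierChar_sub_div hg Φ)
  refine h.congr' (Eventually.of_forall fun t => ?_)
  simp only [Function.comp_apply, zero_add, zero_mul, AddChar.map_zero_eq_one, Circle.coe_one,
    SchwartzMap.smulLeftCLM_const, one_smul, ContinuousLinearMap.coe_id', id, map_smul, map_sub]

end Main

/-! ## 5. Chirps and modulations -/

section Applications

variable (V : Type*) [NormedAddCommGroup V] [InnerProductSpace ℝ V]

/-- **The chirp group is differentiable on Schwartz functions**: `s⁻¹ (T_s Φ - Φ) → 2πi‖x‖² Φ` in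
`𝓢(V, ℂ)` (`T_s Φ = 𝐞(s‖x‖²) Φ`). -/
theorem tendsto_chirpCLM_sub_div (Φ : 𝓢(V, ℂ)) :
    Tendsto (fun s : ℝ => s⁻¹ • (chirpCLM V s Φ - Φ)) (𝓝[≠] 0)
      (𝓝 (SchwartzMap.smulLeftCLM ℂ (fun x : V => 2 * π * I * ((‖x‖ ^ 2 : ℝ) : ℂ)) Φ)) :=
  tendsto_smulLeftCLM_fourierChar_sub_div (g := fun x : V => ‖x‖ ^ 2)
    (Function.hasTemperateGrowth_norm_sq V) Φ

variable [FiniteDimensional ℝ V] [MeasurableSpace V] [BorelSpace V]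

/-- (Ported verbatim from the HodgeCMPerL package; no docstring in the source.) -/
theorem modCLM_smul_eq_smulLeftCLM (b : V) (s : ℝ) (Φ : 𝓢(V, ℂ)) :
    modCLM V (s • b) Φ = SchwartzMap.smulLeftCLM ℂ (fun x => (𝐞 (s * ⟪b, x⟫) : ℂ)) Φ := by
  ext x
  rw [modCLM_apply, SchwartzMap.smulLeftCLM_apply_apply
    (hasTemperateGrowth_fourierChar_mul_comp (Function.hasTemperateGrowth_inner_right b) s),
    real_inner_smul_left, smul_eq_mul]

/-- **The modulation group is differentiable on Schwartz functions**: `s⁻¹ (M_{sb} Φ - Φ) → 2πi⟪b, x⟫ Φ`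
in `𝓢(V, ℂ)`; i.e. the infinitesimal generator of `s ↦ M_{sb}` on `𝓢(V, ℂ)` is multiplication by
`2πi⟪b, ·⟫`, with every Schwartz function in its domain (Schwartz topology). -/
theorem tendsto_modCLM_smul_sub_div (b : V) (Φ : 𝓢(V, ℂ)) :
    Tendsto (fun s : ℝ => s⁻¹ • (modCLM V (s • b) Φ - Φ)) (𝓝[≠] 0)
      (𝓝 (SchwartzMap.smulLeftCLM ℂ (fun x : V => 2 * π * I * ((⟪b, x⟫ : ℝ) : ℂ)) Φ)) := by
  simp_rw [modCLM_smul_eq_smulLeftCLM]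
  exact tendsto_smulLeftCLM_fourierChar_sub_div (Function.hasTemperateGrowth_inner_right b) Φ

end Applications

end SchwartzWeil
end HodgeCM
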